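import Summits.Ventures.Crystal3D.Theorems.StickyWulffConstantTextureLiminfTexShadowInnerLineCount
import Summits.Ventures.Crystal3D.Theorems.StickyWulffConstantGenericWallFloorSampleDeficitOffset
import Summits.Ventures.Crystal3D.Theorems.StickyWulffConstantTextureLiminfTexShadowWallDefs
import HarnessLib

/-!
# The INNER-FACE bond count of a clamped fcc slab sample (lattice level): `2 φ(ν) π ρ² − 60 √2 π ρ ≤ innerBonds`

HONEST FRAMING. Venture `Summits/Ventures/Crystal3D` (cell `crystal3d-full`), helper for the crux `TextureLiminf`
(stmt-Ventures-19483) of `route-Ventures-StickyWulffConstant`, registered line `TexShadow` (cf-p1 gen 29, v6.17, DECISION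
(xlv′)/(xlv″): glue (a) «inner-face count»).  Lane T's cell inequality `BilayerWallAt` carries `½·innerBonds (stacking) P
(beyond)` (stacking bonds from plate balls to stacking sites BEYOND the plate's inner face) where lane F's
`CoaxialTwoSlabAdhesion` / lane G's `TwoSlabLedgerAt` carry `φ(A⁻¹e₃)·πρ²`.  This file proves the conversion for the model
lattice `Λ₀ = fccStacking 1 √(2/3)` with an OFFSET `s`, any unit normal `ν`, any window `[lo, hi]` of height `≥ 1` (the
pulled-back form of a clamped plate of a moved lattice, as in `…GenericWallFloorSampleDeficitOffset`):
**`innerBonds_fcc_offset_window`** — for `P = Λ₀ ∩ {lo ≤ ⟪p + s, ν⟫ ≤ hi, ‖p + s‖² − ⟪p + s, ν⟫² ≤ ρ²}`, `ρ ≥ 1`,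
`2 φ(ν) π ρ² − 60 √2 π ρ ≤ innerBonds Λ₀ P (q ↦ hi < ⟪q + s, ν⟫)`, constant UNIFORM in `ν, s, lo, hi` (R1 of (xlv″)).
Proof: (1) `twelve_ite_le_ncard_touching` — at a site the `innerBonds` summand dominates the twelve indicators
`[beyond (p + w)]`, `w = ±u, ±v, ±t, ±(v−t), ±(u−t), ±(u−v)` (injection into the touching set, finite since
`ncard_touching_barlowPos = 12`); (2) `innerClass_count` — per `⟨110⟩` class the plate sites with `p ± W` beyond the face
number `≥ √2|⟪W,ν⟫|πρ² − 10√2πρ` (`innerLineCount_offset` through the fcc charts of `…SampleDeficitOffset`); (3)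
`∑_W √2|⟪W,ν⟫| = 2φ(ν)` (`finsum_fccShell_abs_inner`).
WHAT THIS IS NOT: the affine transport to `A·Λ₀ + t` and the plate corollaries in `BilayerWallAt`'s literal currency are the
next file (`…TexShadowInnerFaceCount`); no wall statement; rung F-C1 not moved.
-/

noncomputable section

namespace Summit.Ventures.Crystal3D.Theorems

open Summit.Ventures.Crystal3D Finset Matrix
open Summit.Ventures.Crystal3D.Cruxes.TextureLiminf.TexShadow (innerBonds)
open Literature.MathematicalPhysics.StatisticalMechanics (barlowPos barlowStacking fccStacking
  constHagg isHaggSeq_const barlowPos_mem ncard_touching_barlowPos)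
open scoped InnerProductSpace

/-- Sums of fcc sites in coordinates (the constant-Hägg stacking is a lattice). -/
theorem barlowPos_fcc_add (k₁ i₁ j₁ k₂ i₂ j₂ : ℤ) :
    barlowPos 1 (Real.sqrt (2 / 3)) constHagg k₁ i₁ j₁ + barlowPos 1 (Real.sqrt (2 / 3)) constHagg k₂ i₂ j₂ =
      barlowPos 1 (Real.sqrt (2 / 3)) constHagg (k₁ + k₂) (i₁ + i₂) (j₁ + j₂) := by
  rw [barlowPos_fcc_linear 1 _ k₁, barlowPos_fcc_linear 1 _ k₂, barlowPos_fcc_linear 1 _ (k₁ + k₂)]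
  push_cast; module

/-- **(1) The twelve bond indicators at a site are dominated by the `innerBonds` summand.**  For an fcc site
`p = (k, i, j)` and ANY predicate `B`, the number of bond vectors `w ∈ {±u, ±v, ±t, ±(v−t), ±(u−t), ±(u−v)}` with
`B (p + w)` is at most `#{q ∈ Λ₀ : dist p q = 1 ∧ B q}` (an injection into a finite set of `ncard` twelve). -/
theorem twelve_ite_le_ncard_touching (B : EuclideanSpace ℝ (Fin 3) → Prop) [DecidablePred B] (k i j : ℤ) :
    ((if B (barlowPos 1 (Real.sqrt (2 / 3)) constHagg k i j + barlowPos 1 (Real.sqrt (2 / 3)) constHagg 0 1 0)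
        then 1 else 0) +
      (if B (barlowPos 1 (Real.sqrt (2 / 3)) constHagg k i j + barlowPos 1 (Real.sqrt (2 / 3)) constHagg 0 (-1) 0)
        then 1 else 0) +
      (if B (barlowPos 1 (Real.sqrt (2 / 3)) constHagg k i j + barlowPos 1 (Real.sqrt (2 / 3)) constHagg 0 0 1)
        then 1 else 0) +
      (if B (barlowPos 1 (Real.sqrt (2 / 3)) constHagg k i j + barlowPos 1 (Real.sqrt (2 / 3)) constHagg 0 0 (-1))
        then 1 else 0) +
      (if B (barlowPos 1 (Real.sqrt (2 / 3)) constHagg k i j + barlowPos 1 (Real.sqrt (2 / 3)) constHagg 1 0 0)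
        then 1 else 0) +
      (if B (barlowPos 1 (Real.sqrt (2 / 3)) constHagg k i j + barlowPos 1 (Real.sqrt (2 / 3)) constHagg (-1) 0 0)
        then 1 else 0) +
      (if B (barlowPos 1 (Real.sqrt (2 / 3)) constHagg k i j + barlowPos 1 (Real.sqrt (2 / 3)) constHagg (-1) 0 1)
        then 1 else 0) +
      (if B (barlowPos 1 (Real.sqrt (2 / 3)) constHagg k i j + barlowPos 1 (Real.sqrt (2 / 3)) constHagg 1 0 (-1))
        then 1 else 0) +
      (if B (barlowPos 1 (Real.sqrt (2 / 3)) constHagg k i j + barlowPos 1 (Real.sqrt (2 / 3)) constHagg (-1) 1 0)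
        then 1 else 0) +
      (if B (barlowPos 1 (Real.sqrt (2 / 3)) constHagg k i j + barlowPos 1 (Real.sqrt (2 / 3)) constHagg 1 (-1) 0)
        then 1 else 0) +
      (if B (barlowPos 1 (Real.sqrt (2 / 3)) constHagg k i j + barlowPos 1 (Real.sqrt (2 / 3)) constHagg 0 1 (-1))
        then 1 else 0) +
      (if B (barlowPos 1 (Real.sqrt (2 / 3)) constHagg k i j + barlowPos 1 (Real.sqrt (2 / 3)) constHagg 0 (-1) 1)
        then 1 else 0) : ℕ) ≤
      {q : EuclideanSpace ℝ (Fin 3) | q ∈ fccStacking 1 (Real.sqrt (2 / 3)) ∧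
        dist (barlowPos 1 (Real.sqrt (2 / 3)) constHagg k i j) q = 1 ∧ B q}.ncard := by
  set p : EuclideanSpace ℝ (Fin 3) := barlowPos 1 (Real.sqrt (2 / 3)) constHagg k i j with hp
  -- the twelve bond triples, coordinate by coordinate
  set K : Fin 12 → ℤ := ![0, 0, 0, 0, 1, -1, -1, 1, -1, 1, 0, 0] with hK
  set I : Fin 12 → ℤ := ![1, -1, 0, 0, 0, 0, 0, 0, 1, -1, 1, -1] with hI
  set J : Fin 12 → ℤ := ![0, 0, 1, -1, 0, 0, 1, -1, 0, 0, -1, 1] with hJ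
  set V : Fin 12 → EuclideanSpace ℝ (Fin 3) := fun m => barlowPos 1 (Real.sqrt (2 / 3)) constHagg (K m) (I m) (J m)
    with hV
  set F : Finset (Fin 12) := univ.filter fun m => B (p + V m) with hF
  -- the filter's cardinality is the twelve-term sum
  have hsum : F.card =
      (if B (p + barlowPos 1 (Real.sqrt (2 / 3)) constHagg 0 1 0) then 1 else 0) +
      (if B (p + barlowPos 1 (Real.sqrt (2 / 3)) constHagg 0 (-1) 0) then 1 else 0) +
      (if B (p + barlowPos 1 (Real.sqrt (2 / 3)) constHagg 0 0 1) then 1 else 0) +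
      (if B (p + barlowPos 1 (Real.sqrt (2 / 3)) constHagg 0 0 (-1)) then 1 else 0) +
      (if B (p + barlowPos 1 (Real.sqrt (2 / 3)) constHagg 1 0 0) then 1 else 0) +
      (if B (p + barlowPos 1 (Real.sqrt (2 / 3)) constHagg (-1) 0 0) then 1 else 0) +
      (if B (p + barlowPos 1 (Real.sqrt (2 / 3)) constHagg (-1) 0 1) then 1 else 0) +
      (if B (p + barlowPos 1 (Real.sqrt (2 / 3)) constHagg 1 0 (-1)) then 1 else 0) +
      (if B (p + barlowPos 1 (Real.sqrt (2 / 3)) constHagg (-1) 1 0) then 1 else 0) +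
      (if B (p + barlowPos 1 (Real.sqrt (2 / 3)) constHagg 1 (-1) 0) then 1 else 0) +
      (if B (p + barlowPos 1 (Real.sqrt (2 / 3)) constHagg 0 1 (-1)) then 1 else 0) +
      (if B (p + barlowPos 1 (Real.sqrt (2 / 3)) constHagg 0 (-1) 1) then 1 else 0) := by
    rw [hF, Finset.card_filter]
    simp only [hV, hK, hI, hJ, Fin.sum_univ_succ, Fin.sum_univ_zero, Matrix.cons_val_zero, Matrix.cons_val_succ,
      add_zero]
    ring
  -- the quadratic form is `1` on all twelve triples (they are unit bond vectors)
  have hq : ∀ m : Fin 12, I m ^ 2 + J m ^ 2 + K m ^ 2 + I m * J m + I m * K m + J m * K m = 1 := by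
    intro m; rw [hK, hI, hJ]; fin_cases m <;> simp
  -- the triple map is injective
  have hinj3 : Function.Injective (fun m : Fin 12 => (K m, I m, J m)) := by rw [hK, hI, hJ]; decide
  -- the image lies in the touching set
  have hmaps : ∀ m ∈ F, p + V m ∈ {q : EuclideanSpace ℝ (Fin 3) | q ∈ fccStacking 1 (Real.sqrt (2 / 3)) ∧
      dist p q = 1 ∧ B q} := by
    intro m hm
    have hB : B (p + V m) := (Finset.mem_filter.1 hm).2
    refine ⟨?_, ?_, hB⟩
    · rw [hp, hV]; dsimp only
      rw [barlowPos_fcc_add]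
      exact barlowPos_mem _ _ _
    · rw [dist_eq_norm, sub_add_cancel_left, norm_neg, hV]
      exact norm_barlowPos_fcc_eq_one (hq m)
  -- and the map is injective
  have hinj : Set.InjOn (fun m => p + V m) ↑F := by
    intro m _ m' _ h
    have h' : V m = V m' := add_left_cancel h
    rw [hV] at h'
    have h3 := barlowPos_fcc_injective h'
    exact hinj3 h3
  -- the touching set is finite (it has `ncard = 12`)
  have hfin : {q : EuclideanSpace ℝ (Fin 3) | q ∈ fccStacking 1 (Real.sqrt (2 / 3)) ∧ dist p q = 1 ∧ B q}.Finite := by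
    have h12 : {w | w ∈ barlowStacking 1 (Real.sqrt (2 / 3)) constHagg ∧
        dist (barlowPos 1 (Real.sqrt (2 / 3)) constHagg k i j) w = 1}.ncard = 12 :=
      ncard_touching_barlowPos isHaggSeq_const one_pos fcc_height_sq k i j
    have hfin' : {w | w ∈ barlowStacking 1 (Real.sqrt (2 / 3)) constHagg ∧
        dist (barlowPos 1 (Real.sqrt (2 / 3)) constHagg k i j) w = 1}.Finite :=
      Set.finite_of_ncard_ne_zero (by rw [h12]; norm_num)
    refine hfin'.subset ?_
    rintro q ⟨hq1, hq2, -⟩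
    exact ⟨hq1, by rw [hp] at hq2; exact hq2⟩
  have hle := Set.ncard_le_ncard_of_injOn (fun m => p + V m) hmaps hinj hfin
  rw [Set.ncard_coe_finset] at hle
  rw [← hsum]
  exact hle

/-- **(2) One `⟨110⟩` class.** `ν` unit, `lo + 1 ≤ hi`, `ρ ≥ 1`, `s` an offset; `x : Fin N → ℝ³` an enumeration of a sample;
`(Ea, Eb, W)` a unimodular fcc frame (`‖Ea‖, ‖Eb‖ ≤ 1`, `‖W‖ = 1`, `det² = 1/2`), `W' = −W`, and `g` a read-back of the
line coordinates `(a, b)` such that every frame point `a•Ea + b•Eb + t•W` whose offset lies in the sample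
`{lo ≤ ⟪·,ν⟫ ≤ hi, lateral ≤ ρ}` is some `x i₀` with `g i₀ = (a, b)`.  Then the sites with `x i + W` or `x i + W'` beyond
the face `⟪· + s, ν⟫ = hi` number at least `√2 |⟪W,ν⟫| π ρ² − 10 √2 π ρ`. -/
theorem innerClass_count (ν : EuclideanSpace ℝ (Fin 3)) (hν : ‖ν‖ = 1) (s : EuclideanSpace ℝ (Fin 3))
    (lo hi ρ : ℝ) (hlo : lo + 1 ≤ hi) (hρ : 1 ≤ ρ) {N : ℕ} (x : Fin N → EuclideanSpace ℝ (Fin 3))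
    (Ea Eb W W' : EuclideanSpace ℝ (Fin 3)) (hEa : ‖Ea‖ ≤ 1) (hEb : ‖Eb‖ ≤ 1) (hW : ‖W‖ = 1)
    (hdet : (Matrix.det ![WithLp.ofLp Ea, WithLp.ofLp Eb, WithLp.ofLp W]) ^ 2 = 1 / 2) (hW' : W' = -W)
    (g : Fin N → ℤ × ℤ)
    (hg : ∀ a b t : ℤ,
      lo ≤ ⟪(a : ℝ) • Ea + (b : ℝ) • Eb + (t : ℝ) • W + s, ν⟫_ℝ →
      ⟪(a : ℝ) • Ea + (b : ℝ) • Eb + (t : ℝ) • W + s, ν⟫_ℝ ≤ hi →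
      ‖(a : ℝ) • Ea + (b : ℝ) • Eb + (t : ℝ) • W + s‖ ^ 2 -
          ⟪(a : ℝ) • Ea + (b : ℝ) • Eb + (t : ℝ) • W + s, ν⟫_ℝ ^ 2 ≤ ρ ^ 2 →
      ∃ i₀, x i₀ = (a : ℝ) • Ea + (b : ℝ) • Eb + (t : ℝ) • W ∧ g i₀ = (a, b)) :
    Real.sqrt 2 * |⟪W, ν⟫_ℝ| * Real.pi * ρ ^ 2 - 10 * Real.sqrt 2 * Real.pi * ρ ≤
      ((univ.filter fun i => hi < ⟪x i + W + s, ν⟫_ℝ).card : ℝ) +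
        ((univ.filter fun i => hi < ⟪x i + W' + s, ν⟫_ℝ).card : ℝ) := by
  set T : Finset (ℤ × ℤ) :=
    (univ.filter fun i => hi < ⟪x i + W + s, ν⟫_ℝ ∨ hi < ⟪x i + W' + s, ν⟫_ℝ).image g with hT
  have hcount := innerLineCount_offset ν hν ρ lo hi hρ hlo Ea Eb W s hEa hEb hW hdet T (by
    intro a b t h1 h2 h3 h4
    obtain ⟨i₀, hx, hgi⟩ := hg a b t h1 h2 h3
    rw [hT, Finset.mem_image]
    refine ⟨i₀, Finset.mem_filter.2 ⟨Finset.mem_univ _, ?_⟩, hgi⟩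
    have e1 : x i₀ + W + s = (a : ℝ) • Ea + (b : ℝ) • Eb + (t : ℝ) • W + s + W := by rw [hx]; abel
    have e2 : x i₀ + W' + s = (a : ℝ) • Ea + (b : ℝ) • Eb + (t : ℝ) • W + s - W := by rw [hx, hW']; abel
    rw [e1, e2]
    exact h4)
  have h1 : T.card ≤ (univ.filter fun i => hi < ⟪x i + W + s, ν⟫_ℝ ∨ hi < ⟪x i + W' + s, ν⟫_ℝ).card :=
    Finset.card_image_le
  have h2 : (univ.filter fun i => hi < ⟪x i + W + s, ν⟫_ℝ ∨ hi < ⟪x i + W' + s, ν⟫_ℝ).card ≤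
      (univ.filter fun i => hi < ⟪x i + W + s, ν⟫_ℝ).card +
        (univ.filter fun i => hi < ⟪x i + W' + s, ν⟫_ℝ).card := by
    rw [Finset.filter_or]; exact Finset.card_union_le _ _
  have h3 : (T.card : ℝ) ≤ ((univ.filter fun i => hi < ⟪x i + W + s, ν⟫_ℝ).card : ℝ) +
      ((univ.filter fun i => hi < ⟪x i + W' + s, ν⟫_ℝ).card : ℝ) := by
    exact_mod_cast h1.trans h2
  linarith

/-- **(3) The inner-face bond count of a clamped fcc slab sample, lattice level.**  `ν` unit, `lo + 1 ≤ hi`, `ρ ≥ 1`,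
`s` any offset; for the sample `P = Λ₀ ∩ {lo ≤ ⟪p + s, ν⟫ ≤ hi, ‖p + s‖² − ⟪p + s, ν⟫² ≤ ρ²}` of the model fcc lattice,
`2 φ(ν) π ρ² − 60 √2 π ρ ≤ innerBonds Λ₀ P (q ↦ hi < ⟪q + s, ν⟫)` with `φ(ν) = (√2/4) ∑ᶠ_{w ∈ Λ₀, ‖w‖ = 1} |⟪w, ν⟫|`:
the stacking bonds from sample sites to lattice sites strictly beyond the face `⟪· + s, ν⟫ = hi` number at least the
face's broken-bond area, with a constant uniform in `ν, s, lo, hi`. -/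
theorem innerBonds_fcc_offset_window (ν : EuclideanSpace ℝ (Fin 3)) (hν : ‖ν‖ = 1)
    (s : EuclideanSpace ℝ (Fin 3)) (lo hi ρ : ℝ) (hlo : lo + 1 ≤ hi) (hρ : 1 ≤ ρ)
    (P : Finset (EuclideanSpace ℝ (Fin 3)))
    (hP : ∀ p, p ∈ P ↔ (p ∈ fccStacking 1 (Real.sqrt (2 / 3)) ∧ lo ≤ ⟪p + s, ν⟫_ℝ ∧
      ⟪p + s, ν⟫_ℝ ≤ hi ∧ ‖p + s‖ ^ 2 - ⟪p + s, ν⟫_ℝ ^ 2 ≤ ρ ^ 2)) :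
    2 * (Real.sqrt 2 / 4 * ∑ᶠ w ∈ {w ∈ fccStacking 1 (Real.sqrt (2 / 3)) | ‖w‖ = 1}, |⟪w, ν⟫_ℝ|) *
        Real.pi * ρ ^ 2 - 60 * Real.sqrt 2 * Real.pi * ρ ≤
      innerBonds (fccStacking 1 (Real.sqrt (2 / 3))) P (fun q => hi < ⟪q + s, ν⟫_ℝ) := by
  classical
  -- enumerate the sample
  set N : ℕ := P.card with hN
  set x : Fin N → EuclideanSpace ℝ (Fin 3) := fun i => ((P.equivFin.symm i : P) : _) with hxdef
  have hxinj : Function.Injective x := fun i j h => P.equivFin.symm.injective (Subtype.ext h)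
  have himage : univ.image x = P := by
    ext p
    simp only [mem_image, mem_univ, true_and]
    constructor
    · rintro ⟨i, rfl⟩; exact (P.equivFin.symm i).2
    · intro hp; exact ⟨P.equivFin ⟨p, hp⟩, by simp [hxdef]⟩
  have hxP : ∀ p ∈ P, ∃ i, x i = p := fun p hp => ⟨P.equivFin ⟨p, hp⟩, by simp [hxdef]⟩
  have hmem : ∀ i, x i ∈ fccStacking 1 (Real.sqrt (2 / 3)) := fun i => ((hP _).1 (P.equivFin.symm i).2).1
  have hcoord : ∀ i, ∃ k p q : ℤ, x i = barlowPos 1 (Real.sqrt (2 / 3)) constHagg k p q :=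
    fun i => hmem i
  choose kf pf qf hc using hcoord
  -- a lattice site whose offset lies in the sample region is one of the `x i`, with matching coordinates
  have key : ∀ k i j : ℤ,
      lo ≤ ⟪barlowPos 1 (Real.sqrt (2 / 3)) constHagg k i j + s, ν⟫_ℝ →
      ⟪barlowPos 1 (Real.sqrt (2 / 3)) constHagg k i j + s, ν⟫_ℝ ≤ hi →
      ‖barlowPos 1 (Real.sqrt (2 / 3)) constHagg k i j + s‖ ^ 2 -
          ⟪barlowPos 1 (Real.sqrt (2 / 3)) constHagg k i j + s, ν⟫_ℝ ^ 2 ≤ ρ ^ 2 →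
      ∃ i₀, kf i₀ = k ∧ pf i₀ = i ∧ qf i₀ = j := by
    intro k i j h1 h2 h3
    obtain ⟨i₀, hi₀⟩ := hxP _ ((hP _).2 ⟨barlowPos_mem _ _ _, h1, h2, h3⟩)
    rw [hc i₀] at hi₀
    have hh := barlowPos_fcc_injective hi₀
    simp only [Prod.mk.injEq] at hh
    exact ⟨i₀, hh.1, hh.2.1, hh.2.2⟩
  -- unit bond vectors and their negatives
  have hu : ‖barlowPos 1 (Real.sqrt (2 / 3)) constHagg 0 1 0‖ = 1 := norm_barlowPos_fcc_eq_one (by norm_num)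
  have hv : ‖barlowPos 1 (Real.sqrt (2 / 3)) constHagg 0 0 1‖ = 1 := norm_barlowPos_fcc_eq_one (by norm_num)
  have ht : ‖barlowPos 1 (Real.sqrt (2 / 3)) constHagg 1 0 0‖ = 1 := norm_barlowPos_fcc_eq_one (by norm_num)
  have hvt : ‖barlowPos 1 (Real.sqrt (2 / 3)) constHagg (-1) 0 1‖ = 1 := norm_barlowPos_fcc_eq_one (by norm_num)
  have hut : ‖barlowPos 1 (Real.sqrt (2 / 3)) constHagg (-1) 1 0‖ = 1 := norm_barlowPos_fcc_eq_one (by norm_num)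
  have huv : ‖barlowPos 1 (Real.sqrt (2 / 3)) constHagg 0 1 (-1)‖ = 1 := norm_barlowPos_fcc_eq_one (by norm_num)
  have hneg : ∀ k i j : ℤ, barlowPos 1 (Real.sqrt (2 / 3)) constHagg (-k) (-i) (-j) =
      -barlowPos 1 (Real.sqrt (2 / 3)) constHagg k i j := by
    intro k i j
    rw [barlowPos_fcc_linear 1 _ (-k), barlowPos_fcc_linear 1 _ k]; push_cast; module
  have hnu : barlowPos 1 (Real.sqrt (2 / 3)) constHagg 0 (-1) 0 = -barlowPos 1 (Real.sqrt (2 / 3)) constHagg 0 1 0 := by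
    rw [← hneg]; norm_num
  have hnv : barlowPos 1 (Real.sqrt (2 / 3)) constHagg 0 0 (-1) = -barlowPos 1 (Real.sqrt (2 / 3)) constHagg 0 0 1 := by
    rw [← hneg]; norm_num
  have hnt : barlowPos 1 (Real.sqrt (2 / 3)) constHagg (-1) 0 0 = -barlowPos 1 (Real.sqrt (2 / 3)) constHagg 1 0 0 := by
    rw [← hneg]; norm_num
  have hnvt : barlowPos 1 (Real.sqrt (2 / 3)) constHagg 1 0 (-1) = -barlowPos 1 (Real.sqrt (2 / 3)) constHagg (-1) 0 1 :=
    by rw [← hneg]; norm_num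
  have hnut : barlowPos 1 (Real.sqrt (2 / 3)) constHagg 1 (-1) 0 = -barlowPos 1 (Real.sqrt (2 / 3)) constHagg (-1) 1 0 :=
    by rw [← hneg]; norm_num
  have hnuv : barlowPos 1 (Real.sqrt (2 / 3)) constHagg 0 (-1) 1 = -barlowPos 1 (Real.sqrt (2 / 3)) constHagg 0 1 (-1) :=
    by rw [← hneg]; norm_num
  -- (2) the six classes.  Class `u`: frame `(v, v − t, u)`, point `(−b, t, a + b)`, read-back `(j + k, −k)`.
  have cu := innerClass_count ν hν s lo hi ρ hlo hρ x
    (barlowPos 1 (Real.sqrt (2 / 3)) constHagg 0 0 1) (barlowPos 1 (Real.sqrt (2 / 3)) constHagg (-1) 0 1)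
    (barlowPos 1 (Real.sqrt (2 / 3)) constHagg 0 1 0) (barlowPos 1 (Real.sqrt (2 / 3)) constHagg 0 (-1) 0)
    hv.le hvt.le hu (det_sq_barlowPos_fcc (by norm_num)) hnu (fun i => (qf i + kf i, -kf i)) (by
      intro a b t h1 h2 h3
      have hpt : barlowPos 1 (Real.sqrt (2 / 3)) constHagg (-b) t (a + b) =
          (a : ℝ) • barlowPos 1 (Real.sqrt (2 / 3)) constHagg 0 0 1 +
            (b : ℝ) • barlowPos 1 (Real.sqrt (2 / 3)) constHagg (-1) 0 1 +
            (t : ℝ) • barlowPos 1 (Real.sqrt (2 / 3)) constHagg 0 1 0 := by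
        rw [barlowPos_fcc_linear 1 _ (-b) t (a + b), barlowPos_fcc_linear 1 _ (-1) 0 1]
        push_cast; module
      rw [← hpt] at h1 h2 h3
      obtain ⟨i₀, hk, hp, hq⟩ := key _ _ _ h1 h2 h3
      refine ⟨i₀, by rw [hc i₀, hk, hp, hq, hpt], ?_⟩
      exact Prod.ext (by show qf i₀ + kf i₀ = a; omega) (by show -kf i₀ = b; omega))
  -- Class `v`: frame `(u, v − t, v)`, point `(−b, a, b + t)`, read-back `(i, −k)`.
  have cv := innerClass_count ν hν s lo hi ρ hlo hρ x
    (barlowPos 1 (Real.sqrt (2 / 3)) constHagg 0 1 0) (barlowPos 1 (Real.sqrt (2 / 3)) constHagg (-1) 0 1)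
    (barlowPos 1 (Real.sqrt (2 / 3)) constHagg 0 0 1) (barlowPos 1 (Real.sqrt (2 / 3)) constHagg 0 0 (-1))
    hu.le hvt.le hv (det_sq_barlowPos_fcc (by norm_num)) hnv (fun i => (pf i, -kf i)) (by
      intro a b t h1 h2 h3
      have hpt : barlowPos 1 (Real.sqrt (2 / 3)) constHagg (-b) a (b + t) =
          (a : ℝ) • barlowPos 1 (Real.sqrt (2 / 3)) constHagg 0 1 0 +
            (b : ℝ) • barlowPos 1 (Real.sqrt (2 / 3)) constHagg (-1) 0 1 +
            (t : ℝ) • barlowPos 1 (Real.sqrt (2 / 3)) constHagg 0 0 1 := by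
        rw [barlowPos_fcc_linear 1 _ (-b) a (b + t), barlowPos_fcc_linear 1 _ (-1) 0 1]
        push_cast; module
      rw [← hpt] at h1 h2 h3
      obtain ⟨i₀, hk, hp, hq⟩ := key _ _ _ h1 h2 h3
      refine ⟨i₀, by rw [hc i₀, hk, hp, hq, hpt], ?_⟩
      exact Prod.ext (by show pf i₀ = a; omega) (by show -kf i₀ = b; omega))
  -- Class `v − t`: frame `(u, v, v − t)`, point `(−t, a, b + t)`, read-back `(i, j + k)`.
  have cvt := innerClass_count ν hν s lo hi ρ hlo hρ x
    (barlowPos 1 (Real.sqrt (2 / 3)) constHagg 0 1 0) (barlowPos 1 (Real.sqrt (2 / 3)) constHagg 0 0 1)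
    (barlowPos 1 (Real.sqrt (2 / 3)) constHagg (-1) 0 1) (barlowPos 1 (Real.sqrt (2 / 3)) constHagg 1 0 (-1))
    hu.le hv.le hvt (det_sq_barlowPos_fcc (by norm_num)) hnvt (fun i => (pf i, qf i + kf i)) (by
      intro a b t h1 h2 h3
      have hpt : barlowPos 1 (Real.sqrt (2 / 3)) constHagg (-t) a (b + t) =
          (a : ℝ) • barlowPos 1 (Real.sqrt (2 / 3)) constHagg 0 1 0 +
            (b : ℝ) • barlowPos 1 (Real.sqrt (2 / 3)) constHagg 0 0 1 +
            (t : ℝ) • barlowPos 1 (Real.sqrt (2 / 3)) constHagg (-1) 0 1 := by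
        rw [barlowPos_fcc_linear 1 _ (-t) a (b + t), barlowPos_fcc_linear 1 _ (-1) 0 1]
        push_cast; module
      rw [← hpt] at h1 h2 h3
      obtain ⟨i₀, hk, hp, hq⟩ := key _ _ _ h1 h2 h3
      refine ⟨i₀, by rw [hc i₀, hk, hp, hq, hpt], ?_⟩
      exact Prod.ext (by show pf i₀ = a; omega) (by show qf i₀ + kf i₀ = b; omega))
  -- Class `t`: frame `(u − t, u − v, t)`, point `(t − a, a + b, −b)`, read-back `(i + j, −j)`.
  have ct := innerClass_count ν hν s lo hi ρ hlo hρ x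
    (barlowPos 1 (Real.sqrt (2 / 3)) constHagg (-1) 1 0) (barlowPos 1 (Real.sqrt (2 / 3)) constHagg 0 1 (-1))
    (barlowPos 1 (Real.sqrt (2 / 3)) constHagg 1 0 0) (barlowPos 1 (Real.sqrt (2 / 3)) constHagg (-1) 0 0)
    hut.le huv.le ht (det_sq_barlowPos_fcc (by norm_num)) hnt (fun i => (pf i + qf i, -qf i)) (by
      intro a b t h1 h2 h3
      have hpt : barlowPos 1 (Real.sqrt (2 / 3)) constHagg (t - a) (a + b) (-b) =
          (a : ℝ) • barlowPos 1 (Real.sqrt (2 / 3)) constHagg (-1) 1 0 +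
            (b : ℝ) • barlowPos 1 (Real.sqrt (2 / 3)) constHagg 0 1 (-1) +
            (t : ℝ) • barlowPos 1 (Real.sqrt (2 / 3)) constHagg 1 0 0 := by
        rw [barlowPos_fcc_linear 1 _ (t - a) (a + b) (-b), barlowPos_fcc_linear 1 _ (-1) 1 0,
          barlowPos_fcc_linear 1 _ 0 1 (-1)]
        push_cast; module
      rw [← hpt] at h1 h2 h3
      obtain ⟨i₀, hk, hp, hq⟩ := key _ _ _ h1 h2 h3
      refine ⟨i₀, by rw [hc i₀, hk, hp, hq, hpt], ?_⟩
      exact Prod.ext (by show pf i₀ + qf i₀ = a; omega) (by show -qf i₀ = b; omega))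
  -- Class `u − t`: frame `(t, u − v, u − t)`, point `(a − t, b + t, −b)`, read-back `(k + i + j, −j)`.
  have cut := innerClass_count ν hν s lo hi ρ hlo hρ x
    (barlowPos 1 (Real.sqrt (2 / 3)) constHagg 1 0 0) (barlowPos 1 (Real.sqrt (2 / 3)) constHagg 0 1 (-1))
    (barlowPos 1 (Real.sqrt (2 / 3)) constHagg (-1) 1 0) (barlowPos 1 (Real.sqrt (2 / 3)) constHagg 1 (-1) 0)
    ht.le huv.le hut (det_sq_barlowPos_fcc (by norm_num)) hnut (fun i => (kf i + pf i + qf i, -qf i)) (by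
      intro a b t h1 h2 h3
      have hpt : barlowPos 1 (Real.sqrt (2 / 3)) constHagg (a - t) (b + t) (-b) =
          (a : ℝ) • barlowPos 1 (Real.sqrt (2 / 3)) constHagg 1 0 0 +
            (b : ℝ) • barlowPos 1 (Real.sqrt (2 / 3)) constHagg 0 1 (-1) +
            (t : ℝ) • barlowPos 1 (Real.sqrt (2 / 3)) constHagg (-1) 1 0 := by
        rw [barlowPos_fcc_linear 1 _ (a - t) (b + t) (-b), barlowPos_fcc_linear 1 _ (-1) 1 0,
          barlowPos_fcc_linear 1 _ 0 1 (-1)]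
        push_cast; module
      rw [← hpt] at h1 h2 h3
      obtain ⟨i₀, hk, hp, hq⟩ := key _ _ _ h1 h2 h3
      refine ⟨i₀, by rw [hc i₀, hk, hp, hq, hpt], ?_⟩
      exact Prod.ext (by show kf i₀ + pf i₀ + qf i₀ = a; omega) (by show -qf i₀ = b; omega))
  -- Class `u − v`: frame `(t, u − t, u − v)`, point `(a − b, b + t, −t)`, read-back `(k + i + j, i + j)`.
  have cuv := innerClass_count ν hν s lo hi ρ hlo hρ x
    (barlowPos 1 (Real.sqrt (2 / 3)) constHagg 1 0 0) (barlowPos 1 (Real.sqrt (2 / 3)) constHagg (-1) 1 0)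
    (barlowPos 1 (Real.sqrt (2 / 3)) constHagg 0 1 (-1)) (barlowPos 1 (Real.sqrt (2 / 3)) constHagg 0 (-1) 1)
    ht.le hut.le huv (det_sq_barlowPos_fcc (by norm_num)) hnuv (fun i => (kf i + pf i + qf i, pf i + qf i)) (by
      intro a b t h1 h2 h3
      have hpt : barlowPos 1 (Real.sqrt (2 / 3)) constHagg (a - b) (b + t) (-t) =
          (a : ℝ) • barlowPos 1 (Real.sqrt (2 / 3)) constHagg 1 0 0 +
            (b : ℝ) • barlowPos 1 (Real.sqrt (2 / 3)) constHagg (-1) 1 0 +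
            (t : ℝ) • barlowPos 1 (Real.sqrt (2 / 3)) constHagg 0 1 (-1) := by
        rw [barlowPos_fcc_linear 1 _ (a - b) (b + t) (-t), barlowPos_fcc_linear 1 _ (-1) 1 0,
          barlowPos_fcc_linear 1 _ 0 1 (-1)]
        push_cast; module
      rw [← hpt] at h1 h2 h3
      obtain ⟨i₀, hk, hp, hq⟩ := key _ _ _ h1 h2 h3
      refine ⟨i₀, by rw [hc i₀, hk, hp, hq, hpt], ?_⟩
      exact Prod.ext (by show kf i₀ + pf i₀ + qf i₀ = a; omega) (by show pf i₀ + qf i₀ = b; omega))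
  -- (1) pointwise: the twelve indicators at `x i` are dominated by the `innerBonds` summand
  have h12 : ∀ i : Fin N,
      ((if hi < ⟪x i + barlowPos 1 (Real.sqrt (2 / 3)) constHagg 0 1 0 + s, ν⟫_ℝ then 1 else 0) +
        (if hi < ⟪x i + barlowPos 1 (Real.sqrt (2 / 3)) constHagg 0 (-1) 0 + s, ν⟫_ℝ then 1 else 0) +
        (if hi < ⟪x i + barlowPos 1 (Real.sqrt (2 / 3)) constHagg 0 0 1 + s, ν⟫_ℝ then 1 else 0) +
        (if hi < ⟪x i + barlowPos 1 (Real.sqrt (2 / 3)) constHagg 0 0 (-1) + s, ν⟫_ℝ then 1 else 0) +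
        (if hi < ⟪x i + barlowPos 1 (Real.sqrt (2 / 3)) constHagg 1 0 0 + s, ν⟫_ℝ then 1 else 0) +
        (if hi < ⟪x i + barlowPos 1 (Real.sqrt (2 / 3)) constHagg (-1) 0 0 + s, ν⟫_ℝ then 1 else 0) +
        (if hi < ⟪x i + barlowPos 1 (Real.sqrt (2 / 3)) constHagg (-1) 0 1 + s, ν⟫_ℝ then 1 else 0) +
        (if hi < ⟪x i + barlowPos 1 (Real.sqrt (2 / 3)) constHagg 1 0 (-1) + s, ν⟫_ℝ then 1 else 0) +
        (if hi < ⟪x i + barlowPos 1 (Real.sqrt (2 / 3)) constHagg (-1) 1 0 + s, ν⟫_ℝ then 1 else 0) +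
        (if hi < ⟪x i + barlowPos 1 (Real.sqrt (2 / 3)) constHagg 1 (-1) 0 + s, ν⟫_ℝ then 1 else 0) +
        (if hi < ⟪x i + barlowPos 1 (Real.sqrt (2 / 3)) constHagg 0 1 (-1) + s, ν⟫_ℝ then 1 else 0) +
        (if hi < ⟪x i + barlowPos 1 (Real.sqrt (2 / 3)) constHagg 0 (-1) 1 + s, ν⟫_ℝ then 1 else 0) : ℕ) ≤
      {q : EuclideanSpace ℝ (Fin 3) | q ∈ fccStacking 1 (Real.sqrt (2 / 3)) ∧ dist (x i) q = 1 ∧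
        hi < ⟪q + s, ν⟫_ℝ}.ncard := by
    intro i
    have h := twelve_ite_le_ncard_touching (fun q => hi < ⟪q + s, ν⟫_ℝ) (kf i) (pf i) (qf i)
    rw [← hc i] at h
    exact h
  have hsum12 := Finset.sum_le_sum fun i (_ : i ∈ (univ : Finset (Fin N))) => h12 i
  -- regroup the left-hand side by classes
  have hcards :
      (univ.filter fun i => hi < ⟪x i + barlowPos 1 (Real.sqrt (2 / 3)) constHagg 0 1 0 + s, ν⟫_ℝ).card +
      (univ.filter fun i => hi < ⟪x i + barlowPos 1 (Real.sqrt (2 / 3)) constHagg 0 (-1) 0 + s, ν⟫_ℝ).card +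
      (univ.filter fun i => hi < ⟪x i + barlowPos 1 (Real.sqrt (2 / 3)) constHagg 0 0 1 + s, ν⟫_ℝ).card +
      (univ.filter fun i => hi < ⟪x i + barlowPos 1 (Real.sqrt (2 / 3)) constHagg 0 0 (-1) + s, ν⟫_ℝ).card +
      (univ.filter fun i => hi < ⟪x i + barlowPos 1 (Real.sqrt (2 / 3)) constHagg 1 0 0 + s, ν⟫_ℝ).card +
      (univ.filter fun i => hi < ⟪x i + barlowPos 1 (Real.sqrt (2 / 3)) constHagg (-1) 0 0 + s, ν⟫_ℝ).card +
      (univ.filter fun i => hi < ⟪x i + barlowPos 1 (Real.sqrt (2 / 3)) constHagg (-1) 0 1 + s, ν⟫_ℝ).card +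
      (univ.filter fun i => hi < ⟪x i + barlowPos 1 (Real.sqrt (2 / 3)) constHagg 1 0 (-1) + s, ν⟫_ℝ).card +
      (univ.filter fun i => hi < ⟪x i + barlowPos 1 (Real.sqrt (2 / 3)) constHagg (-1) 1 0 + s, ν⟫_ℝ).card +
      (univ.filter fun i => hi < ⟪x i + barlowPos 1 (Real.sqrt (2 / 3)) constHagg 1 (-1) 0 + s, ν⟫_ℝ).card +
      (univ.filter fun i => hi < ⟪x i + barlowPos 1 (Real.sqrt (2 / 3)) constHagg 0 1 (-1) + s, ν⟫_ℝ).card +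
      (univ.filter fun i => hi < ⟪x i + barlowPos 1 (Real.sqrt (2 / 3)) constHagg 0 (-1) 1 + s, ν⟫_ℝ).card ≤
      ∑ i : Fin N, {q : EuclideanSpace ℝ (Fin 3) | q ∈ fccStacking 1 (Real.sqrt (2 / 3)) ∧ dist (x i) q = 1 ∧
        hi < ⟪q + s, ν⟫_ℝ}.ncard := by
    simpa only [Finset.card_filter, Finset.sum_add_distrib] using hsum12
  -- the right-hand side is `innerBonds`
  have hIB : innerBonds (fccStacking 1 (Real.sqrt (2 / 3))) P (fun q => hi < ⟪q + s, ν⟫_ℝ) =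
      ∑ i : Fin N, (({q : EuclideanSpace ℝ (Fin 3) | q ∈ fccStacking 1 (Real.sqrt (2 / 3)) ∧ dist (x i) q = 1 ∧
        hi < ⟪q + s, ν⟫_ℝ}.ncard : ℕ) : ℝ) := by
    unfold innerBonds
    rw [← himage, Finset.sum_image fun i _ j _ h => hxinj h]
  have hcast := (Nat.cast_le (α := ℝ)).2 hcards
  rw [Nat.cast_sum, ← hIB] at hcast
  push_cast at hcast
  -- (3) the six classes add up to `2 φ(ν)`
  obtain ⟨euv, eut, evt⟩ := fcc_bond_differences
  rw [finsum_fccShell_abs_inner ν, euv, eut, evt]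
  linarith [cu, cv, cvt, ct, cut, cuv, hcast]

end Summit.Ventures.Crystal3D.Theorems

end
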